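import Literature.AlgebraicGeometry.Frobenioids.DivisorMonoidCategoryTheoreticityCorSchemaNegativeB
import Literature.AlgebraicGeometry.Frobenioids.DivisorMonoidCategoryTheoreticity
import HarnessLib

/-!
# Frobenioids I, Theorem 4.9 and Corollary 4.12 AS TYPED over the data-only interfaces: the universal
# closures are false — kernel `¬ ∀` (FACT-LIST rows F-1032 `Thm49`, F-1031 `Cor412`; schema / R5)

Mochizuki, *The geometry of Frobenioids I: the general theory*, Kyushu J. Math. **62** (2008) 293–400,
Thm. 4.9 "Category-theoreticity of Divisor Monoids", kurims text pp. 88–89, and Cor. 4.12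
"Category-theoreticity of the Functor to an Elementary Frobenioid II", pp. 94–95
[cite: MochizukiFrdI2008, Thm. 4.9 p.88] [cite: MochizukiFrdI2008, Cor. 4.12 p.95].

PROOF-ONLY companion (no definitions, no instances; cell abc-iut, block F fact-proving wave, seat
abc-iut-f-034 = the original seat of tranche 34, complementing abc-iut-f-027's INSTANCE-FORM files
`Thm49AsPrinted.lean` / `Cor412AsPrinted.lean` under f-027's leases) of seat abc-iut-L1-t3's
`DivisorMonoidCategoryTheoreticity.lean`, in the style and on the toolkit of abc-iut-f-032's
`DivisorMonoidCategoryTheoreticityCorSchemaNegative(B).lean` (degenerate operations on `B(N_{≥1})`: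
`deg_Fr = id`, `Div = 0`, identity pull-backs; of STANDARD type — the one object is isotropic and no
iso-subanchor since its irreducible arrows are the infinitely many primes; junk "rationally standard"
parameters `CorSchemaNegative.exists_rsParams`). Both typed items quantify over the bare operations interface
`PreFrobenioidData` and the data-only parameters `R_i : RSParams S_i` (whose defining file says "a data-only
interface admits junk instances — never quantify universally over it"); their universal closures (at universe
level `0`) are refuted in the kernel:

* `PreFrobenioidData.not_forall_thm49` (F-1032): on the SAME category `B(N_{≥1})` over `Discrete PUnit` take the
  degenerate operations with divisor monoid `ℤ_{≥0}` and with divisor monoid `ℤ_{≥0}²`; both are "of rationally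
  standard type" at junk parameters, `Ψ := 𝟭`, yet an isomorphism of functors `Ψ^Φ : Φ₁ ⥲ Φ₂` over `Ψ` would be a
  monoid isomorphism `ℤ_{≥0} ≃ ℤ_{≥0}²`, and `ℤ_{≥0}²` is not monogenic — the abstract category `C` does not see
  the rank of a freely chosen `Φ`;
* `PreFrobenioidData.not_forall_cor412` (F-1031): the degenerate operations over the two Frobenius-slim bases
  `Discrete PUnit`, `Discrete Bool` (f-032's device for Cor. 4.11 (ii)/(iii)), `Ψ := 𝟭`, junk rationally
  standard parameters, hypothesis (b) vacuous: a `Ψ⁰ : F_{0_{D₁}} ⥲ F_{0_{D₂}}` would be an equivalence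
  `Discrete PUnit × B(N_{≥1}) ⥲ Discrete Bool × B(N_{≥1})`, impossible since `(false, ∗) ≇ (true, ∗)` while the
  source has one object.

INSTANCE FORMS (the printed statements, for Frobenioids `C_i → F_{Φ_i}` at `PreFrobenioidData.ofFunctor`) are
PROVED in the tree and are what consumers bind: Thm. 4.9 — `FrdI.T49.thm49_ofFunctor_of_isOfFSMType`
(abc-iut-w4-d109, `Thm49Assembly.lean`), `…_of_isOfFSMFFType2024`, `thm49_ofFunctor_of_preservesPreSteps`
(abc-iut-w4-d105), and f-027's `FrdI.T49.thm49_ofFunctor` (`Thm49AsPrinted.lean`, no base hypothesis; pending on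
the gate at the time of writing); Cor. 4.12 — `PreFrobenioid.cor412_of_isOfFSMType` / `cor412_rsParams_of_isOfFSMType`
(abc-iut-w5-d222, `Cor412Closed.lean`, `Cor412Unconditional.lean`), `cor412_arith` (abc-iut-L1-d1), and f-027's
`FrdI.cor412_ofFunctor` / `cor412_rsParams` (`Cor412AsPrinted.lean`). So F-1031/F-1032 read «universal-closure
REFUTED; instance form PROVED» (cell rules R1/R5). A refuted closure is a statement about the typing, not about
the paper; nothing here bears on [IUTchIII] Cor. 3.12 or takes a side.
-/

namespace Literature.AlgebraicGeometry.Frobenioids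

open CategoryTheory

namespace PreFrobenioidData

open CorSchemaNegative

/-! ### `ℤ_{≥0}²` is not monogenic -/

/-- `ℤ_{≥0}` and `ℤ_{≥0} × ℤ_{≥0}` (written multiplicatively) are not isomorphic monoids: every element of a
monoid isomorphic to `ℤ_{≥0}` is a power of the image of `1`, but `(1, 0)` and `(0, 1)` are not powers of one
element. [folklore] -/
private theorem not_nonempty_mulEquiv_nat_prod :
    ¬ Nonempty (Multiplicative ℕ ≃* Multiplicative ℕ × Multiplicative ℕ) := by
  rintro ⟨e⟩
  have key : ∀ y : Multiplicative ℕ × Multiplicative ℕ, ∃ n : ℕ, y = e (Multiplicative.ofAdd 1) ^ n := by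
    intro y
    refine ⟨Multiplicative.toAdd (e.symm y), ?_⟩
    rw [← map_pow, ← ofAdd_nsmul, smul_eq_mul, mul_one, ofAdd_toAdd, MulEquiv.apply_symm_apply]
  obtain ⟨n, hn⟩ := key (Multiplicative.ofAdd 1, 1)
  obtain ⟨m, hm⟩ := key (1, Multiplicative.ofAdd 1)
  have h1 := congrArg (fun p => Multiplicative.toAdd p.1) hn
  have h3 := congrArg (fun p => Multiplicative.toAdd p.1) hm
  have h4 := congrArg (fun p => Multiplicative.toAdd p.2) hm
  simp only [Prod.pow_fst, Prod.pow_snd, toAdd_pow, toAdd_ofAdd, toAdd_one, smul_eq_mul] at h1 h3 h4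
  have ha : Multiplicative.toAdd (e (Multiplicative.ofAdd 1)).1 = 1 :=
    Nat.eq_one_of_mul_eq_one_left h1.symm
  rw [ha, mul_one] at h3
  rw [← h3, zero_mul] at h4
  exact one_ne_zero h4

/-! ### F-1032: the universal closure of `Thm49` is false -/

/-- **F-1032 (FACT-LIST), schema negative.** The universal closure of the typed [FrdI] Thm. 4.9
`PreFrobenioidData.Thm49 S₁ S₂ Ψ R₁ R₂` — quantified over the data-only operations interface
`PreFrobenioidData` and parameters `RSParams` — is false: on `C₁ = C₂ = B(N_{≥1})` over `Discrete PUnit`, the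
degenerate operations with `Φ₁ ≡ ℤ_{≥0}` and with `Φ₂ ≡ ℤ_{≥0}²` are both of rationally standard type at junk
parameters (`CorSchemaNegative.isOfStandardType`, `exists_rsParams`), `Ψ := 𝟭`, and an isomorphism of functors
`Ψ^Φ : Φ₁ ⥲ Φ₂` lying over `Ψ` (`DivisorMonoidIsoOver`) would restrict to `ℤ_{≥0} ≃ ℤ_{≥0}²`
(`not_nonempty_mulEquiv_nat_prod`). The printed statement is the instance at Frobenioids, PROVED in the tree
(`FrdI.T49.thm49_ofFunctor_of_isOfFSMType`, `…_of_isOfFSMFFType2024`, `thm49_ofFunctor_of_preservesPreSteps`;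
f-027's `FrdI.T49.thm49_ofFunctor`). [cite: MochizukiFrdI2008, Thm. 4.9 p.88] -/
theorem not_forall_thm49 :
    ¬ ∀ (C₁ : Type) [Category.{0} C₁] (D₁ : Type) [Category.{0} D₁]
        (C₂ : Type) [Category.{0} C₂] (D₂ : Type) [Category.{0} D₂]
        (S₁ : PreFrobenioidData.{0} C₁ D₁) (S₂ : PreFrobenioidData.{0} C₂ D₂) (Ψ : C₁ ≌ C₂)
        (R₁ : RSParams.{0, 0, 0, 0, 0, 0} S₁) (R₂ : RSParams.{0, 0, 0, 0, 0, 0} S₂),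
        S₁.Thm49 S₂ Ψ R₁ R₂ := by
  intro h
  -- the degenerate operations on `B(N_{≥1})` over `Discrete PUnit` with `Φ ≡ ℤ_{≥0}` …
  let S₁ : PreFrobenioidData.{0} (SingleObj ℕ+) (Discrete PUnit.{1}) :=
    { base := (Functor.const _).obj ⟨PUnit.unit⟩
      Mon := fun _ => Multiplicative ℕ
      pull := fun _ => MonoidHom.id _
      pull_id := fun _ _ => rfl
      pull_comp := fun _ _ _ => rfl
      div := fun _ => 1
      degFr := fun φ => φ
      div_id := fun _ => rfl
      div_comp := fun _ _ => by simp
      degFr_id := fun _ => rfl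
      degFr_comp := fun ψ φ => mul_comm (show ℕ+ from φ) (show ℕ+ from ψ) }
  -- … and with `Φ ≡ ℤ_{≥0}²`
  let S₂ : PreFrobenioidData.{0} (SingleObj ℕ+) (Discrete PUnit.{1}) :=
    { base := (Functor.const _).obj ⟨PUnit.unit⟩
      Mon := fun _ => Multiplicative ℕ × Multiplicative ℕ
      pull := fun _ => MonoidHom.id _
      pull_id := fun _ _ => rfl
      pull_comp := fun _ _ _ => rfl
      div := fun _ => 1
      degFr := fun φ => φ
      div_id := fun _ => rfl
      div_comp := fun _ _ => by simp
      degFr_id := fun _ => rfl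
      degFr_comp := fun ψ φ => mul_comm (show ℕ+ from φ) (show ℕ+ from ψ) }
  have hdeg₁ : ∀ {x y : SingleObj ℕ+} (φ : x ⟶ y), S₁.degFr φ = φ := fun _ => rfl
  have hdeg₂ : ∀ {x y : SingleObj ℕ+} (φ : x ⟶ y), S₂.degFr φ = φ := fun _ => rfl
  have hM₁ : ∀ A : SingleObj ℕ+, ∃ m : S₁.Mon (S₁.base.obj A), m ≠ 1 := fun _ =>
    ⟨Multiplicative.ofAdd (1 : ℕ), fun h0 =>
      one_ne_zero (Multiplicative.ofAdd.injective ((show Multiplicative.ofAdd (1 : ℕ) = 1 from h0).trans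
        ofAdd_zero.symm))⟩
  have hM₂ : ∀ A : SingleObj ℕ+, ∃ m : S₂.Mon (S₂.base.obj A), m ≠ 1 := fun _ =>
    ⟨(Multiplicative.ofAdd (1 : ℕ), 1), fun h0 =>
      one_ne_zero (Multiplicative.ofAdd.injective
        ((congrArg Prod.fst (show ((Multiplicative.ofAdd (1 : ℕ), (1 : Multiplicative ℕ)) :
          Multiplicative ℕ × Multiplicative ℕ) = 1 from h0)).trans ofAdd_zero.symm))⟩
  have hst₁ : S₁.IsOfStandardType :=
    isOfStandardType S₁ hdeg₁ (fun _ => rfl) (fun f => inferInstance) hM₁ (fun _ _ _ => rfl)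
  have hst₂ : S₂.IsOfStandardType :=
    isOfStandardType S₂ hdeg₂ (fun _ => rfl) (fun f => inferInstance) hM₂ (fun _ _ _ => rfl)
  obtain ⟨R₁, hR₁⟩ := exists_rsParams S₁ hdeg₁ hM₁ ⟨PUnit.unit⟩ hst₁
  obtain ⟨R₂, hR₂⟩ := exists_rsParams S₂ hdeg₂ hM₂ ⟨PUnit.unit⟩ hst₂
  obtain ⟨E⟩ := h _ _ _ _ S₁ S₂ CategoryTheory.Equivalence.refl R₁ R₂ hR₁ hR₂
  exact not_nonempty_mulEquiv_nat_prod ⟨E.iso (SingleObj.star ℕ+)⟩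

/-! ### F-1031: the universal closure of `Cor412` is false -/

/-- **F-1031 (FACT-LIST), schema negative.** The universal closure of the typed [FrdI] Cor. 4.12
`PreFrobenioidData.Cor412 S₁ S₂ Ψ R₁ R₂` — quantified over the data-only operations interface
`PreFrobenioidData` and parameters `RSParams` — is false: for the degenerate operations on `B(N_{≥1})` over the
Frobenius-slim bases `Discrete PUnit` and `Discrete Bool` (`CorSchemaNegative.exists_degenerate`; `Ψ := 𝟭`; both
of rationally standard type at junk parameters; hypothesis (b) vacuous, the operations being not of group-like
type) a `1`-unique `Ψ⁰ : F_{0_{D₁}} → F_{0_{D₂}}` would be an EQUIVALENCE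
`Discrete PUnit × B(N_{≥1}) ⥲ Discrete Bool × B(N_{≥1})`; its quasi-inverse sends `(false, ∗)`, `(true, ∗)` to
the unique object of the source, forcing `(false, ∗) ≅ (true, ∗)`, i.e. `false = true`. The printed statement is
the instance at Frobenioids, PROVED in the tree (`PreFrobenioid.cor412_of_isOfFSMType`,
`cor412_rsParams_of_isOfFSMType`, `cor412_arith`; f-027's `FrdI.cor412_ofFunctor` / `cor412_rsParams`).
[cite: MochizukiFrdI2008, Cor. 4.12 p.95] -/
theorem not_forall_cor412 :
    ¬ ∀ (C₁ : Type) [Category.{0} C₁] (D₁ : Type) [Category.{0} D₁]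
        (C₂ : Type) [Category.{0} C₂] (D₂ : Type) [Category.{0} D₂]
        (S₁ : PreFrobenioidData.{0} C₁ D₁) (S₂ : PreFrobenioidData.{0} C₂ D₂) (Ψ : C₁ ≌ C₂)
        (R₁ : RSParams.{0, 0, 0, 0, 0, 0} S₁) (R₂ : RSParams.{0, 0, 0, 0, 0, 0} S₂),
        S₁.Cor412 S₂ Ψ R₁ R₂ := by
  intro h
  obtain ⟨S₁, hdeg₁, hdiv₁, hM₁, hpull₁⟩ := exists_degenerate (D := Discrete PUnit.{1}) ⟨⟨⟩⟩
  obtain ⟨S₂, hdeg₂, hdiv₂, hM₂, hpull₂⟩ := exists_degenerate (D := Discrete Bool) ⟨true⟩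
  have hst₁ := isOfStandardType S₁ hdeg₁ hdiv₁ (fun f => inferInstance) hM₁ hpull₁
  have hst₂ := isOfStandardType S₂ hdeg₂ hdiv₂ (fun f => inferInstance) hM₂ hpull₂
  obtain ⟨R₁, hR₁⟩ := exists_rsParams S₁ hdeg₁ hM₁ ⟨⟨⟩⟩ hst₁
  obtain ⟨R₂, hR₂⟩ := exists_rsParams S₂ hdeg₂ hM₂ ⟨true⟩ hst₂
  -- the two bases are slim (their Hom-sets are subsingletons), hence Frobenius-slim
  have hFs₁ : IsFrobeniusSlim (Discrete PUnit.{1}) :=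
    (⟨fun _ _ => Iso.ext (NatTrans.ext (funext fun _ => Subsingleton.elim _ _))⟩ :
      IsSlim (Discrete PUnit.{1})).isFrobeniusSlim
  have hFs₂ : IsFrobeniusSlim (Discrete Bool) :=
    (⟨fun _ _ => Iso.ext (NatTrans.ext (funext fun _ => Subsingleton.elim _ _))⟩ :
      IsSlim (Discrete Bool)).isFrobeniusSlim
  -- hypothesis (b) is vacuous: `S₁` is not of group-like type
  have hB : HypB S₁ S₂ CategoryTheory.Equivalence.refl :=
    fun hG _ => (not_isOfGroupLikeType S₁ hM₁ hG).elim
  obtain ⟨Ψ0, ⟨hE, -, -⟩, -⟩ := h _ _ _ _ S₁ S₂ CategoryTheory.Equivalence.refl R₁ R₂ hFs₁ hFs₂ hR₁ hR₂ hB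
  haveI := hE
  -- the quasi-inverse of `Ψ⁰` identifies `(false, ∗)` and `(true, ∗)`
  let X : Discrete Bool × SingleObj ℕ+ := (⟨false⟩, SingleObj.star ℕ+)
  let Y : Discrete Bool × SingleObj ℕ+ := (⟨true⟩, SingleObj.star ℕ+)
  have hXY : Ψ0.inv.obj X = Ψ0.inv.obj Y := Subsingleton.elim _ _
  let i : X ≅ Y :=
    (Ψ0.asEquivalence.counitIso.app X).symm ≪≫ eqToIso (congrArg Ψ0.obj hXY) ≪≫
      Ψ0.asEquivalence.counitIso.app Y
  exact Bool.false_ne_true (Discrete.eq_of_hom ((CategoryTheory.Prod.fst _ _).mapIso i).hom)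

end PreFrobenioidData

end Literature.AlgebraicGeometry.Frobenioids
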